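import Summits.RiemannHypothesis.RiemannHypothesis.Theorems.PfPersistenceMarkovCoreWindowStability
import HarnessLib

/-!
# PF persistence (theory 1, edge law): THE MARKOV CORE, XVI — the Feynman–Hellmann theorem for the
# WINDOW EDGE (Hadamard's formula for the arch-only core): `a ε′(a) = ∫₀^∞ (tρ)′(s) D_s(Φ_a) ds`
# at EVERY window, `ε ∈ C¹(0, ∞)`, `ε′ ≤ 0`

Helper file (`--supports stmt-RiemannHypothesis-19953`); mechanism/rigidity campaign; no RH claims.
Companion text `run/shared/lean/pub/pub-rhpf/pub-rhpf-theory-1/THEORY-EDGE-8.md`.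

File XIII proved the Feynman–Hellmann theorem in the WEIGHTS (`w ↦ ε(a; w)` is `C¹` on the
non-negative orthant at a fixed window).  This file proves it in the WINDOW for the arch-only core
`ε(a) = archBottom a = inf {𝓔_arch(f) : f ∈ coreAdm a, ‖f‖₂ = 1}` — the parameter now moves the
DOMAIN, and the dilation `weilDilate (b/a − 1)` of file XIV turns the moving domain into a moving
KERNEL on a fixed domain:

* `window_bounds` — the two-sided supergradient sandwich with ONE kernel: for core ground states `u`
  of the window `a` and `v` of the window `b`,
  `(b/a − 1) ∫ archSlope (b/a) · D(v moved to a) ≤ ε(b) − ε(a) ≤ (b/a − 1) ∫ archSlope (b/a) · D(u)`;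
* `hasDerivAt_archBottom` — **`ε′(a) = (1/a) ∫₀^∞ (tρ)′(s) D_s(u) ds = archWindowResponse a / a`
  at EVERY `a > 0`**, for every (any) core ground state `u` of the window `a`: the moved ground
  states of the windows `b → a` converge to `u` (file XV), their increments converge pointwise
  (file VIII), the kernels `archSlope (b/a) → (tρ)′` under the domination `C e^{−s/8}` (file XIV);
* `continuousOn_archWindowResponse`, `archBottom_C1`, `contDiffOn_archBottom` — `ε ∈ C¹(0, ∞)`;
  `archWindowResponse_nonpos` — `ε′ ≤ 0` (larger windows lower the bottom);
* `hasDerivAt_coreBottom_of_lt_half_log_two` — below the first prime EVERY table (ζ's included) has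
  `ε(·; w) = archBottom`, hence the same `C¹` law;
* `edgeLaw_archBottom` — the EDGE LAW in virial form: `a ε′(a) = −V`, `V` the derivative at `η = 0`
  of the energy `𝓔_arch(weilDilate η u)` along the dilation orbit of the ground state
  (`hasDerivAt_archEnergy_orbit`, file `PfPersistenceArchVirial`).

All of this holds for EVERY windowed form of this type (it is STRUCTURE of the variational problem,
not an invariant of ζ): what the prime atoms add is the only possible source of
non-differentiability of the full `ε(a; w)` in the window (an atom `log n` entering at `a = ½ log n`,
files `PfPersistenceEdgeLawKink*`; the interior lags, THEORY-EDGE §3 H-diff-a).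

References: T. Kato, *Perturbation Theory for Linear Operators* (1966), VII §4, VIII §§3–4;
E. Bombieri, Rend. Mat. Acc. Lincei (9) 11 (2000) 183–233, §4 Thm 3, Thm 5 (the dilation argument);
M. Reed, B. Simon, *Methods of Modern Mathematical Physics IV* (1978), §XIII.1.
-/

set_option linter.dupNamespace false

noncomputable section

open MeasureTheory Set Filter Metric
open scoped Topology

namespace Summit.RiemannHypothesis.RiemannHypothesis.Theorems.PfPersistence

open Literature.NumberTheory.LFunctions
open Summit.RiemannHypothesis.RiemannHypothesis.Theorems.WeilWindowFlowWindowLipschitz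
  (stub_barrierEnergy_weilIncrement_le_four stub_localizedCut_aesm_weilIncrement)
open Summit.RiemannHypothesis.RiemannHypothesis.Theorems.WeilGroundStateMarkovPart
open Summit.RiemannHypothesis.RiemannHypothesis.Theorems.OddSector (memLp_weilDilate)

variable {a b : ℝ}

/-! ## §1 The window response -/

/-- The WINDOW RESPONSE of the arch-only core at the window `a`:
`archWindowResponse a = ∫₀^∞ (tρ)′(s) D_s(Φ_a) ds`, `D_s(Φ_a) = coreResponse 0 a s` the increment of
the (any) arch-only core ground state (file XII). [cite: Kato1966, VIII §§3–4] -/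
def archWindowResponse (a : ℝ) : ℝ :=
  ∫ s in Ioi (0 : ℝ), weilArchVirialDensity s * coreResponse (fun _ ↦ (0 : ℝ)) a s

/-- The window response is computed by every core ground state. [folklore] -/
theorem archWindowResponse_eq (ha : 0 < a) {u : ℝ → ℂ} (hu : IsCoreGround (fun _ ↦ (0 : ℝ)) a u) :
    archWindowResponse a = ∫ s in Ioi (0 : ℝ), weilArchVirialDensity s * weilIncrement u s := by
  unfold archWindowResponse
  simp_rw [coreResponse_eq (archOnly_nonneg a) ha hu]

/-- **The virial along the dilation orbit of a ground state**: `η ↦ 𝓔_arch(weilDilate η u)` has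
derivative `−archWindowResponse a` at `η = 0`. [cite: Bombieri2000Weil, §4 proof of Thm 5] -/
theorem hasDerivAt_archEnergy_orbit (ha : 0 < a) {u : ℝ → ℂ}
    (hu : IsCoreGround (fun _ ↦ (0 : ℝ)) a u) :
    HasDerivAt (fun η ↦ archEnergy (weilDilate η u)) (-archWindowResponse a) 0 := by
  rw [archWindowResponse_eq ha hu]
  exact hasDerivAt_archEnergy_weilDilate hu.1.1 hu.1.2.2

/-! ## §2 The supergradient sandwich in the window -/

/-- **THE SUPERGRADIENT SANDWICH IN THE WINDOW (one kernel, two states).**  For arch-only core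
ground states `u` of the window `a` and `v` of the window `b` (`a, b > 0`),
`(b/a − 1) ∫ archSlope (b/a) s · D_s(weilDilate (b/a − 1) v) ≤ archBottom b − archBottom a
 ≤ (b/a − 1) ∫ archSlope (b/a) s · D_s(u)`:
upper — move `u` to the window `b` and use the variational principle there; lower — move `v` to the
window `a`, use the variational principle at `a`, and undo the move in the energy.
[cite: Kato1966, VIII §3 (4.14)–(4.16)] -/
theorem window_bounds (ha : 0 < a) (hb : 0 < b) {u v : ℝ → ℂ}
    (hu : IsCoreGround (fun _ ↦ (0 : ℝ)) a u) (hv : IsCoreGround (fun _ ↦ (0 : ℝ)) b v) :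
    (b / a - 1) * ∫ s in Ioi (0 : ℝ), archSlope (b / a) s *
        weilIncrement (weilDilate (b / a - 1) v) s ≤ archBottom b - archBottom a ∧
      archBottom b - archBottom a ≤
        (b / a - 1) * ∫ s in Ioi (0 : ℝ), archSlope (b / a) s * weilIncrement u s := by
  constructor
  · -- lower bound: move `v` to the window `a`
    obtain ⟨hη, hηinv, -⟩ := windowShift_param ha hb
    obtain ⟨hθ, hθinv, -⟩ := windowShift_param hb ha
    set h : ℝ → ℂ := weilDilate (b / a - 1) v with hhdef
    have hh : coreAdm a h := coreAdm_windowShift hv.1 ha hb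
    have hhn : ∫ x, ‖h x‖ ^ 2 = (1 : ℝ) := by
      rw [hhdef, integral_norm_sq_weilDilate _ hη, hv.2.1]
    have h1 : archBottom a ≤ archEnergy h := archBottom_le hh hhn
    have h2 : archEnergy v = archEnergy h +
        ((1 + (a / b - 1))⁻¹ - 1) * ∫ s in Ioi (0 : ℝ), archSlope (1 + (a / b - 1))⁻¹ s *
          weilIncrement h s := by
      rw [← archEnergy_weilDilate hh.1 hh.2.2 hθ, hhdef, weilDilate_windowShift_roundtrip ha hb]
    rw [hθinv] at h2
    linarith [hv.archEnergy_eq]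
  · -- upper bound: move `u` to the window `b`
    obtain ⟨hθ, hθinv, -⟩ := windowShift_param hb ha
    have h1 : archBottom b ≤ archEnergy (weilDilate (a / b - 1) u) :=
      archBottom_le (coreAdm_windowShift hu.1 hb ha)
        (by rw [integral_norm_sq_weilDilate _ hθ, hu.2.1])
    rw [archEnergy_weilDilate hu.1.1 hu.1.2.2 hθ, hθinv, hu.archEnergy_eq] at h1
    linarith

/-! ## §3 Dominated convergence of the window pairings -/

/-- **The window pairings converge to the response pairing.**  If `μ_k → 1` (`μ_k ≠ 1`
eventually), `f_k ∈ L²` are normalised and `D_s(f_k) → D_s(u)` for every `s > 0`, then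
`∫ archSlope μ_k · D(f_k) → ∫ (tρ)′ · D(u)` (domination `|archSlope μ s| D_s ≤ 4C e^{−s/8}` for
`μ ≥ ½`, file XIV). [cite: ReedSimonIV1978, §XIII.1] -/
theorem tendsto_integral_archSlope_mul {μ : ℕ → ℝ} (hμ : Tendsto μ atTop (𝓝[≠] (1 : ℝ)))
    {f : ℕ → ℝ → ℂ} {u : ℝ → ℂ} (hf : ∀ k, MemLp (f k) 2)
    (hfn : ∀ k, ∫ x, ‖f k x‖ ^ 2 = (1 : ℝ))
    (hD : ∀ s, 0 < s → Tendsto (fun k ↦ weilIncrement (f k) s) atTop (𝓝 (weilIncrement u s))) :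
    Tendsto (fun k ↦ ∫ s in Ioi (0 : ℝ), archSlope (μ k) s * weilIncrement (f k) s) atTop
      (𝓝 (∫ s in Ioi (0 : ℝ), weilArchVirialDensity s * weilIncrement u s)) := by
  have hμ1 : Tendsto μ atTop (𝓝 1) := tendsto_nhds_of_tendsto_nhdsWithin hμ
  have hev : ∀ᶠ k in atTop, 1 / 2 ≤ μ k := hμ1.eventually (Ici_mem_nhds (by norm_num))
  refine tendsto_integral_filter_of_dominated_convergence
    (fun s ↦ archVirialConst * Real.exp (-(1 / 8) * s) * 4) ?_ ?_ ?_ ?_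
  · filter_upwards [hev] with k hk
    exact (integrableOn_archSlope_mul_weilIncrement (hf k) (by linarith)).aestronglyMeasurable
  · filter_upwards [hev] with k hk
    refine (ae_restrict_iff' measurableSet_Ioi).2 (Eventually.of_forall fun s hs ↦ ?_)
    have hs0 : (0 : ℝ) < s := hs
    rw [norm_mul, Real.norm_eq_abs, Real.norm_eq_abs, abs_of_nonneg (weilIncrement_nonneg _ _)]
    have h2 : weilIncrement (f k) s ≤ 4 := by
      have h := stub_barrierEnergy_weilIncrement_le_four (hf k) s
      rwa [hfn k, mul_one] at h
    exact mul_le_mul (abs_archSlope_le_of_half_le hk hs0) h2 (weilIncrement_nonneg _ _)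
      (mul_nonneg archVirialConst_pos.le (Real.exp_pos _).le)
  · exact ((exp_neg_integrableOn_Ioi 0 (by norm_num : (0 : ℝ) < 1 / 8)).const_mul _).mul_const _
  · refine (ae_restrict_iff' measurableSet_Ioi).2 (Eventually.of_forall fun s hs ↦ ?_)
    exact ((tendsto_archSlope hs).comp hμ).mul (hD s hs)

/-! ## §4 The Feynman–Hellmann theorem in the window -/

/-- **FEYNMAN–HELLMANN IN THE WINDOW (Hadamard's formula for the arch-only Markov core).**
For every `a > 0` the arch-only window bottom `ε(a) = archBottom a` is differentiable at `a` with
`ε′(a) = archWindowResponse a / a = (1/a) ∫₀^∞ (tρ)′(s) D_s(Φ_a) ds` — at EVERY window, with no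
hypothesis (no non-degeneracy, no arithmetic input): the window analogue of file XIII.
[cite: Kato1966, VII §4 and VIII §§3–4; Bombieri2000Weil, §4 Thm 5] -/
theorem hasDerivAt_archBottom (ha : 0 < a) :
    HasDerivAt archBottom (archWindowResponse a / a) a := by
  obtain ⟨u, hu⟩ := exists_isCoreGround (archOnly_nonneg a) ha
  rw [archWindowResponse_eq ha hu, hasDerivAt_iff_tendsto_slope, tendsto_iff_seq_tendsto]
  intro x hx
  have hxa : Tendsto x atTop (𝓝 a) := tendsto_nhds_of_tendsto_nhdsWithin hx
  have hne : ∀ᶠ k in atTop, x k ≠ a :=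
    (hx.eventually (self_mem_nhdsWithin : ({a}ᶜ : Set ℝ) ∈ 𝓝[≠] a)).mono fun k hk ↦ by
      simpa using hk
  obtain ⟨b, hb0, hba, hbx⟩ := clamp_seq ha hxa
  -- ground states of the windows `b k`; moved to `a` they converge to `u` modulo phases (file XV)
  choose v hv using fun k ↦ exists_isCoreGround (archOnly_nonneg (b k)) (hb0 k)
  obtain ⟨c, hcn, hlim⟩ := hu.tendsto_of_windows ha hb0 hba hv
  set L : ℝ := ∫ s in Ioi (0 : ℝ), weilArchVirialDensity s * weilIncrement u s with hLdef
  have hμ : Tendsto (fun k ↦ b k / a) atTop (𝓝[≠] 1) := by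
    refine tendsto_nhdsWithin_iff.2 ⟨by simpa [div_self ha.ne'] using hba.div_const a, ?_⟩
    filter_upwards [hne, hbx] with k hk hk'
    rw [mem_compl_singleton_iff, hk', Ne, div_eq_one_iff_eq ha.ne']
    exact hk
  -- the two pairings converge to `L`
  have hUp : Tendsto (fun k ↦ ∫ s in Ioi (0 : ℝ), archSlope (b k / a) s * weilIncrement u s)
      atTop (𝓝 L) :=
    tendsto_integral_archSlope_mul hμ (fun _ ↦ hu.1.1) (fun _ ↦ hu.2.1)
      (fun _ _ ↦ tendsto_const_nhds)
  have hm : ∀ k, MemLp (weilDilate (b k / a - 1) (v k)) 2 := fun k ↦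
    memLp_weilDilate (hv k).1.1 (windowShift_param ha (hb0 k)).1
  have hLo : Tendsto (fun k ↦ ∫ s in Ioi (0 : ℝ), archSlope (b k / a) s *
      weilIncrement (weilDilate (b k / a - 1) (v k)) s) atTop (𝓝 L) :=
    tendsto_integral_archSlope_mul hμ hm
      (fun k ↦ by rw [integral_norm_sq_weilDilate _ (windowShift_param ha (hb0 k)).1, (hv k).2.1])
      (fun s _ ↦ tendsto_weilIncrement_of_tendsto_phase hu.1.1 hm hcn hlim)
  -- squeeze of the slopes between the two pairings
  have hmin := (hLo.div_const a).min (hUp.div_const a)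
  have hmax := (hLo.div_const a).max (hUp.div_const a)
  rw [min_self] at hmin
  rw [max_self] at hmax
  refine tendsto_of_tendsto_of_tendsto_of_le_of_le' hmin hmax ?_ ?_
  · filter_upwards [hne, hbx] with k hk hk'
    simp only [Function.comp_apply, slope_def_field]
    rw [← hk']
    have hd : b k - a ≠ 0 := by rw [hk']; exact sub_ne_zero.2 hk
    have hwb := window_bounds ha (hb0 k) hu (hv k)
    exact (slope_mem_of_bounds ha hd hwb.1 hwb.2).1
  · filter_upwards [hne, hbx] with k hk hk'
    simp only [Function.comp_apply, slope_def_field]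
    rw [← hk']
    have hd : b k - a ≠ 0 := by rw [hk']; exact sub_ne_zero.2 hk
    have hwb := window_bounds ha (hb0 k) hu (hv k)
    exact (slope_mem_of_bounds ha hd hwb.1 hwb.2).2

/-- The same, for any chosen core ground state `u` of the window `a`:
`ε′(a) = (1/a) ∫₀^∞ (tρ)′(s) D_s(u) ds`. [cite: Kato1966, VIII §§3–4] -/
theorem hasDerivAt_archBottom_of_isCoreGround (ha : 0 < a) {u : ℝ → ℂ}
    (hu : IsCoreGround (fun _ ↦ (0 : ℝ)) a u) :
    HasDerivAt archBottom
      ((∫ s in Ioi (0 : ℝ), weilArchVirialDensity s * weilIncrement u s) / a) a := by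
  rw [← archWindowResponse_eq ha hu]
  exact hasDerivAt_archBottom ha

/-- **`ε′ ≤ 0`**: the window response is non-positive (`archBottom` is antitone, file XV).
[cite: Bombieri2000Weil, Thm 5] -/
theorem archWindowResponse_nonpos (ha : 0 < a) : archWindowResponse a ≤ 0 := by
  have hslope : Tendsto (slope archBottom a) (𝓝[≠] a) (𝓝 (archWindowResponse a / a)) :=
    hasDerivAt_iff_tendsto_slope.1 (hasDerivAt_archBottom ha)
  have hle : ∀ᶠ b in 𝓝[≠] a, slope archBottom a b ≤ 0 := by
    filter_upwards [mem_nhdsWithin_of_mem_nhds (Ioi_mem_nhds ha),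
      (self_mem_nhdsWithin : ({a}ᶜ : Set ℝ) ∈ 𝓝[≠] a)] with b hb hba
    rw [mem_compl_singleton_iff] at hba
    rw [slope_def_field]
    rcases lt_trichotomy b a with hlt | heq | hgt
    · have h := archBottom_antitoneOn hb (mem_Ioi.2 ha) hlt.le
      rw [div_le_iff_of_neg (sub_neg.2 hlt)]
      linarith
    · exact absurd heq hba
    · have h := archBottom_antitoneOn (mem_Ioi.2 ha) hb hgt.le
      rw [div_le_iff₀ (sub_pos.2 hgt)]
      linarith
  have h := le_of_tendsto hslope hle
  have h' := (div_le_iff₀ ha).1 h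
  linarith

/-! ## §5 Continuity of the response: `ε ∈ C¹(0, ∞)` -/

/-- The window response at `b`, read off on the window `a` after the move (substitution
`s = (b/a) τ`): `archWindowResponse b = (b/a) ∫₀^∞ (tρ)′((b/a)τ) D_τ(weilDilate (b/a − 1) v) dτ`
for a core ground state `v` of the window `b`. [folklore] -/
theorem archWindowResponse_eq_moved (ha : 0 < a) (hb : 0 < b) {v : ℝ → ℂ}
    (hv : IsCoreGround (fun _ ↦ (0 : ℝ)) b v) :
    archWindowResponse b = (b / a) * ∫ τ in Ioi (0 : ℝ), weilArchVirialDensity (b / a * τ) *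
      weilIncrement (weilDilate (b / a - 1) v) τ := by
  rw [archWindowResponse_eq hb hv]
  have hν : 0 < b / a := div_pos hb ha
  have e : ∀ τ, weilIncrement (weilDilate (b / a - 1) v) τ = weilIncrement v (b / a * τ) := by
    intro τ
    rw [weilIncrement_weilDilate _ (windowShift_param ha hb).1]
    congr 1
    ring
  simp_rw [e]
  have h := integral_comp_mul_left_Ioi
    (fun s ↦ weilArchVirialDensity s * weilIncrement v s) 0 hν
  simp only [mul_zero] at h
  rw [h, smul_eq_mul, ← mul_assoc, mul_inv_cancel₀ hν.ne', one_mul]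

/-- **The window response is continuous on `(0, ∞)`** (window stability of the ground state,
file XV, + dominated convergence). [cite: Kato1966, VIII §§3–4] -/
theorem continuousAt_archWindowResponse (ha : 0 < a) : ContinuousAt archWindowResponse a := by
  rw [ContinuousAt, tendsto_iff_seq_tendsto]
  intro x hx
  obtain ⟨u, hu⟩ := exists_isCoreGround (archOnly_nonneg a) ha
  obtain ⟨b, hb0, hba, hbx⟩ := clamp_seq ha hx
  choose v hv using fun k ↦ exists_isCoreGround (archOnly_nonneg (b k)) (hb0 k)
  obtain ⟨c, hcn, hlim⟩ := hu.tendsto_of_windows ha hb0 hba hv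
  have hm : ∀ k, MemLp (weilDilate (b k / a - 1) (v k)) 2 := fun k ↦
    memLp_weilDilate (hv k).1.1 (windowShift_param ha (hb0 k)).1
  have hν1 : Tendsto (fun k ↦ b k / a) atTop (𝓝 1) := by
    simpa [div_self ha.ne'] using hba.div_const a
  have hev : ∀ᶠ k in atTop, 1 / 2 ≤ b k / a := hν1.eventually (Ici_mem_nhds (by norm_num))
  -- dominated convergence for the moved pairings
  have hJ : Tendsto (fun k ↦ ∫ τ in Ioi (0 : ℝ), weilArchVirialDensity (b k / a * τ) *
      weilIncrement (weilDilate (b k / a - 1) (v k)) τ) atTop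
      (𝓝 (∫ s in Ioi (0 : ℝ), weilArchVirialDensity s * weilIncrement u s)) := by
    refine tendsto_integral_filter_of_dominated_convergence
      (fun s ↦ archVirialConst * Real.exp (-(1 / 8) * s) * 4) ?_ ?_ ?_ ?_
    · exact Eventually.of_forall fun k ↦
        ((measurable_weilArchVirialDensity.comp (measurable_id.const_mul _)).aestronglyMeasurable.mul
          (stub_localizedCut_aesm_weilIncrement (hm k).1)).restrict
    · filter_upwards [hev] with k hk
      refine (ae_restrict_iff' measurableSet_Ioi).2 (Eventually.of_forall fun s hs ↦ ?_)
      have hs0 : (0 : ℝ) < s := hs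
      rw [norm_mul, Real.norm_eq_abs, Real.norm_eq_abs,
        abs_of_nonneg (weilIncrement_nonneg _ _)]
      have h1 : |weilArchVirialDensity (b k / a * s)| ≤ archVirialConst * Real.exp (-(1 / 8) * s) :=
        (abs_weilArchVirialDensity_le_archVirialConst (by positivity)).trans
          (mul_le_mul_of_nonneg_left (Real.exp_le_exp.2 (by nlinarith))
            archVirialConst_pos.le)
      have h2 : weilIncrement (weilDilate (b k / a - 1) (v k)) s ≤ 4 := by
        have h := stub_barrierEnergy_weilIncrement_le_four (hm k) s
        rwa [integral_norm_sq_weilDilate _ (windowShift_param ha (hb0 k)).1, (hv k).2.1,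
          mul_one] at h
      exact mul_le_mul h1 h2 (weilIncrement_nonneg _ _)
        (mul_nonneg archVirialConst_pos.le (Real.exp_pos _).le)
    · exact ((exp_neg_integrableOn_Ioi 0 (by norm_num : (0 : ℝ) < 1 / 8)).const_mul _).mul_const _
    · refine (ae_restrict_iff' measurableSet_Ioi).2 (Eventually.of_forall fun s hs ↦ ?_)
      have hs0 : (0 : ℝ) < s := hs
      have h1 : Tendsto (fun k ↦ weilArchVirialDensity (b k / a * s)) atTop
          (𝓝 (weilArchVirialDensity s)) := by
        have h0 : Tendsto (fun k ↦ b k / a * s) atTop (𝓝 s) := by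
          simpa using hν1.mul_const s
        exact (continuousAt_weilArchVirialDensity hs0.ne').tendsto.comp h0
      exact h1.mul (tendsto_weilIncrement_of_tendsto_phase hu.1.1 hm hcn hlim)
  have hlimR : Tendsto (fun k ↦ archWindowResponse (b k)) atTop (𝓝 (archWindowResponse a)) := by
    rw [archWindowResponse_eq ha hu]
    have h := hν1.mul hJ
    rw [one_mul] at h
    exact h.congr fun k ↦ (archWindowResponse_eq_moved ha (hb0 k) (hv k)).symm
  exact hlimR.congr' (hbx.mono fun k hk ↦ by rw [Function.comp_apply, hk])

/-- `archWindowResponse` is continuous on `(0, ∞)`. [cite: Kato1966, VIII §§3–4] -/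
theorem continuousOn_archWindowResponse : ContinuousOn archWindowResponse (Ioi 0) :=
  continuousOn_of_forall_continuousAt fun _ ha ↦ continuousAt_archWindowResponse ha

/-- **`ε ∈ C¹(0, ∞)` for the arch-only core**: derivative `archWindowResponse a / a` at every
`a > 0`, continuous on `(0, ∞)`. [cite: Kato1966, VII §4, VIII §§3–4] -/
theorem archBottom_C1 :
    (∀ a ∈ Ioi (0 : ℝ), HasDerivAt archBottom (archWindowResponse a / a) a) ∧
      ContinuousOn (fun a ↦ archWindowResponse a / a) (Ioi 0) :=
  ⟨fun _ ha ↦ hasDerivAt_archBottom ha,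
    continuousOn_archWindowResponse.div continuousOn_id fun _ ha ↦ ne_of_gt ha⟩

/-- `deriv archBottom` is continuous on `(0, ∞)`. [cite: Kato1966, VII §4, VIII §§3–4] -/
theorem continuousOn_deriv_archBottom : ContinuousOn (deriv archBottom) (Ioi 0) :=
  archBottom_C1.2.congr fun _ ha ↦ (hasDerivAt_archBottom ha).deriv

/-- `archBottom` is `C¹` on `(0, ∞)` in Mathlib's sense. [cite: Kato1966, VII §4, VIII §§3–4] -/
theorem contDiffOn_archBottom : ContDiffOn ℝ 1 archBottom (Ioi 0) := by
  rw [show (1 : WithTop ℕ∞) = 0 + 1 from rfl, contDiffOn_succ_iff_deriv_of_isOpen isOpen_Ioi]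
  refine ⟨fun a ha ↦ (hasDerivAt_archBottom ha).differentiableAt.differentiableWithinAt,
    by simp, ?_⟩
  rw [contDiffOn_zero]
  exact continuousOn_deriv_archBottom

/-! ## §6 Every table below the first prime; the edge law in virial form -/

/-- **Below the first prime every table is arch-only**: for `a < ½ log 2` the index
`{n : log n < 2a}` is `{0, 1}` and `D_{log 0} = D_{log 1} = D_0 = 0`, so
`𝓔^w_a(f) = 𝓔_arch(f)` for EVERY table `w`. [folklore] -/
theorem tableDirichletEnergy_of_lt_half_log_two (w : ℕ → ℝ) (ha : a < Real.log 2 / 2)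
    (f : ℝ → ℂ) : tableDirichletEnergy a w f = archEnergy f := by
  unfold tableDirichletEnergy archEnergy
  rw [Finset.sum_eq_zero, zero_add]
  intro n hn
  have hlt : Real.log n < Real.log 2 := by
    have h := mem_weilPrimeIndex.1 hn
    linarith
  have hn2 : n < 2 := by
    by_contra h
    push Not at h
    have h2 : Real.log 2 ≤ Real.log n :=
      Real.log_le_log (by norm_num) (by exact_mod_cast h)
    linarith
  have hlog : Real.log (n : ℝ) = 0 := by
    interval_cases n <;> simp
  have hD : weilIncrement f 0 = 0 := by simp [weilIncrement]
  rw [hlog, hD, mul_zero]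

/-- … hence below the first prime every table has the arch-only bottom. [folklore] -/
theorem coreBottom_of_lt_half_log_two (w : ℕ → ℝ) (ha : a < Real.log 2 / 2) :
    coreBottom w a = archBottom a := by
  unfold archBottom coreBottom coreSet
  simp only [tableDirichletEnergy_of_lt_half_log_two w ha, tableDirichletEnergy_archOnly]

/-- … and the same core ground states. [folklore] -/
theorem isCoreGround_iff_of_lt_half_log_two (w : ℕ → ℝ) (ha : a < Real.log 2 / 2) (u : ℝ → ℂ) :
    IsCoreGround w a u ↔ IsCoreGround (fun _ ↦ (0 : ℝ)) a u := by
  unfold IsCoreGround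
  rw [tableDirichletEnergy_of_lt_half_log_two w ha, tableDirichletEnergy_archOnly,
    coreBottom_of_lt_half_log_two w ha, archBottom]

/-- **Below the first prime every table obeys the arch-only `C¹` law**: for `0 < a < ½ log 2` and
ANY weights `w` (ζ's `zetaTable` included), `ε(·; w)` has derivative `archWindowResponse a / a`
at `a`. [cite: Kato1966, VIII §§3–4] -/
theorem hasDerivAt_coreBottom_of_lt_half_log_two (w : ℕ → ℝ) (ha : 0 < a)
    (h2 : a < Real.log 2 / 2) : HasDerivAt (coreBottom w) (archWindowResponse a / a) a := by
  refine (hasDerivAt_archBottom ha).congr_of_eventuallyEq ?_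
  filter_upwards [Iio_mem_nhds h2] with b hb
  exact coreBottom_of_lt_half_log_two w hb

/-- **THE EDGE LAW (virial form) for the arch-only core, at every window.**  If `V` is the
derivative at `η = 0` of the energy `𝓔_arch(weilDilate η u)` along the dilation orbit of a core
ground state `u` of the window `a` (the dilation virial), then `a ε′(a) = −V`.
[cite: Bombieri2000Weil, §4 Thm 5; Kato1966, VIII §§3–4] -/
theorem edgeLaw_archBottom (ha : 0 < a) {u : ℝ → ℂ} (hu : IsCoreGround (fun _ ↦ (0 : ℝ)) a u)
    {V : ℝ} (hV : HasDerivAt (fun η ↦ archEnergy (weilDilate η u)) V 0) :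
    a * deriv archBottom a = -V := by
  have h1 : -archWindowResponse a = V := (hasDerivAt_archEnergy_orbit ha hu).unique hV
  rw [(hasDerivAt_archBottom ha).deriv, ← h1]
  field_simp

end Summit.RiemannHypothesis.RiemannHypothesis.Theorems.PfPersistence

end
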